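import Literature.MathematicalPhysics.QuantumFieldTheory.Balaban1983to89.Node00.RateRecordW1MapsAdm
import Literature.MathematicalPhysics.QuantumFieldTheory.Balaban1983to89.T4InputCauchyRateData
import Literature.MathematicalPhysics.QuantumFieldTheory.Balaban1983to89.Node00.HistoryAdmissibleClass

/-!
# Node O ∕ W1-14 — the GERM READING of the history data of [II] §2 (2.13)–(2.14) at a level `k` of the torus catalogue of record

Balaban's step-`n` renormalization transformation reads the OLDER effective-action terms `E^{(j)}(X; g₀,…,g_{j−1}; 𝐔, 𝐉)`, `j < n`, as ANALYTIC
GERMS on the complex tables `U^c_j(X, α₀, α₁)` ([I] §1 p.263, (1.18); [II] (1.33) p.9, (1.41) p.11, (2.13)–(2.14) pp.14–15): the new term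
`E^{(n)}` is produced from the whole germ of the history, not from its values at one background.  The W1 files of record type the history as
`old : OlderTerms = (j : Fin (k+1)) → 𝐃_j → CPair → ℂ` (`HistoryRecursionOfRecord`, `StepGen.T`), i.e. as germs; the two-run comparison
schema `T4InputCauchyRateData.StepModel` is stated over ABSTRACT carriers `T4OutputRate.Carriers`.  This file supplies the carriers on which the
history half of that schema is read faithfully for the pair of runs (torus `k`, torus `k+1`) of a `T4Family`:

* `W1.GermIdx F M N k sp`, `W1.germCarriers` — the GERM INDICES at level `k`: a run-A localization domain `X ∈ Σ j, 𝐃_j(F.P k)`, a point `ψ` of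
  run B's analyticity table `sp (k+1)` at the paired domain `πX` (`pairOfRecord`), and a real∕imaginary-part tag; scale and tree length are those
  of `X`; the background slots are trivial (the configuration IS in the index).
* `W1.EAgerm S Tcfg`, `W1.EBgerm S′ b` — the two runs' terms read at the germ point: run B at `ψ`, run A at the transported configuration
  `Tcfg ψ` (a configuration transport `CPair (F.P (k+1)) 𝔸 → CPair (F.P k) 𝔸` extending the background transport on readings — a HYPOTHESIS
  SCHEMA, `hTcfg` below; its construction is scale geometry, not this file's).
* `W1.ne5_readingAdm_of_germ` — the RESTRICTION FACE: `NE5` over the germ carriers implies node N18's `NE5` literal at the admissible reading of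
  record (`ReadingData.ne5_ofRecordAdm_iff`), by evaluation at the index of an admissible background with the tag `Re`.
* `W1.GermHist.HistSp I := lp (fun _ ↦ ℂ) ∞` with the ℝ-linear reading `embAll` of real tables (faces on bounded tables only), and
  `W1.insOfRecord κ c ω rHist n` — the history insertion of record at step `n`: the table below scale `n`, weighted by the age factor
  `c·ω^{n−1−j}` ([II] (1.24) p.7: older terms enter with geometrically decreasing weight), the history radius `rHist n` and `e^{κ d_j}`.
* `W1.histStepModel` — the HISTORY HALF of a `StepModel` over the germ carriers (`insA = insB := insOfRecord`; output map, operator data, base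
  class and margins PARAMETRIC), with the faces `insAffine_histStepModel`, `insBlind_histStepModel`, `insHomog_histStepModel`,
  `insertionRate_histStepModel` (`δ′ = 0`), `insScaleBound_histStepModel`: the insertion laws L08∕L09 of the schema hold BY CONSTRUCTION here.
* `W1.decayBound_EBgerm_of_sizeAdm` — the (1.18) size class `SizeAdm` (`HistoryAdmissibleClass`) on run B's terms gives `DecayBound` of the
  germ family (`d_j(πX) = d_j(X)`).

HONESTY.  Nothing here is analysis: the operator rate (L07), the output majorant (`hH`) and the representation of the two runs' terms by the
output map (L01∕L02) keep all the two-run content of [II] §2 and are NOT asserted; `NE5` is neither in print as a theorem nor proved here.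
PRICE of the insertion of record (recorded, not discharged): a scale-`j` germ table of size `E₁e^{−κ d}` moves the history by at most
`rHist n · c · ω^{n−1−j} · E₁` (`insScaleBound_histStepModel`), so an output majorant over the history ball of radius `rHist n` must tolerate
scale-`j` germ perturbations of relative size `(c ω^{n−1−j})⁻¹` — print's age factor `Lʲη` ([II] (1.24) p.7); `1∕L < ω < θ′` is the intended range.
THE CONFIGURATION TRANSPORT `Tcfg` is a displayed PARAMETER with its two laws taken as hypotheses exactly where read — the background face
`Tcfg (ιU, 0) = (ι(T₀U), 0)` (`ne5_readingAdm_of_germ`) and the table clause `ψ ∈ sp (k+1) (πX) → Tcfg ψ ∈ sp k X`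
(`decayBound_EAgerm_of_sizeAdm`); it is NOT instantiated here (in particular not by the injective extension of the background reading, which would
read run A's terms at junk configurations off the real slice): the intended inhabitant is the analytic extension of the block average [I] (0.4)
to small complex configurations composed with the level identification of the two tori — scale geometry of a later file.
No type-class declarations, custom syntax or attribute changes are introduced (typer lint).

References: [I] = T. Balaban, Commun. Math. Phys. 109 (1987) 249–301 (`Balaban1987RG1`); [II] = T. Balaban, Commun. Math. Phys. 116 (1988)
1–22 (`Balaban1988RG2Cluster`).
-/

noncomputable section

namespace Literature.MathematicalPhysics.QuantumFieldTheory.Balaban1983to89.Node00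

open Literature.MathematicalPhysics.QuantumFieldTheory.Balaban1983to89
open TreeLengthTorus T4Continuum Sect2
open Literature.MathematicalPhysics.QuantumFieldTheory.Balaban1983to89.T4OutputRate (Carriers Functional Window NE5 DecayBound)
open Literature.MathematicalPhysics.QuantumFieldTheory.Balaban1983to89.T4InputCauchyRateData (StepModel)
open scoped ENNReal

namespace W1

variable (F : T4Family) (M N : ℕ) (k : ℕ)
variable (sp : (k j : ℕ) → (domSys (F.P k) M j).Dom → Set (CPair (F.P k) (MatA N)))

/-- **THE GERM INDICES AT LEVEL `k`**: a run-A domain `X = (j, X₂) ∈ Σ j, 𝐃_j(F.P k)`, a POINT of run B's analyticity table at the paired domain `πX`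
(a configuration of the `(k+1)`-th torus), and a real∕imaginary-part tag. [cite: Balaban1987RG1, §1 p.263 (the tables U^c_j(X, α₀, α₁) and (1.18)); Balaban1988RG2Cluster, (2.13)-(2.14) pp.14-15] -/
def GermIdx : Type :=
  Σ X : W1.Dom (F.P k) M, ↥(sp (k + 1) (pairOfRecord F M k X).1 (pairOfRecord F M k X).2) × Bool

/-- real (`true`) or imaginary (`false`) part of a complex value (bookkeeping: the rate schema is real-valued, the terms complex-analytic). [cite: Balaban1987RG1, §1 p.263 (bookkeeping)] -/
def reIm : Bool → ℂ → ℝ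
  | true, z => z.re
  | false, z => z.im

/-- Face. [cite: Balaban1987RG1, §1 p.263 (bookkeeping)] -/
@[simp] theorem reIm_true (z : ℂ) : reIm true z = z.re := rfl

/-- Face. [cite: Balaban1987RG1, §1 p.263 (bookkeeping)] -/
@[simp] theorem reIm_false (z : ℂ) : reIm false z = z.im := rfl

/-- **THE GERM CARRIERS OF RECORD AT LEVEL `k`**: domains = germ indices (scale and tree length those of the run-A domain), trivial background slots
(the configuration argument is IN the index), identity transport. [cite: Balaban1987RG1, (1.17)-(1.18) p.263 (scale j, tree length d_j); Balaban1988RG2Cluster, (2.14) p.15] -/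
abbrev germCarriers : Carriers where
  Dom := GermIdx F M N k sp
  scale := fun i => i.1.1
  d := fun i => (domSys (F.P k) M i.1.1).dj i.1.2
  d_nonneg := fun i => (domSys (F.P k) M i.1.1).dj_nonneg i.1.2
  BgA := Unit
  BgB := Unit
  gauge := fun _ _ => 0
  gauge_nonneg := fun _ _ => le_rfl
  transport := id

/-- **RUN A's GERM FUNCTIONAL**: at index `(X, ψ, τ)` the `τ`-part of `E_A^{(j)}(X; g; Tcfg ψ)` — run A's term read at the TRANSPORTED table point. [cite: Balaban1988RG2Cluster, (2.13) p.14 and (1.41) p.11 (the previous-torus terms read on the new torus' fields)] -/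
def EAgerm (S : ClusterTower (F.P k) (MatA N) M) (Tcfg : CPair (F.P (k + 1)) (MatA N) → CPair (F.P k) (MatA N)) :
    Functional (germCarriers F M N k sp) Unit :=
  fun g _ i => reIm i.2.2 (functionalC S g (Tcfg i.2.1.1) i.1)

/-- **RUN B's GERM FAMILY** (first coupling `b` prepended): at index `(X, ψ, τ)` the `τ`-part of `E_B^{(j+1)}(πX; b∷g; ψ)`. [cite: Balaban1988RG2Cluster, (2.13)-(2.14) pp.14-15] -/
def EBgerm (S' : ClusterTower (F.P (k + 1)) (MatA N) M) (b : ℝ) : Functional (germCarriers F M N k sp) Unit :=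
  fun g _ i => reIm i.2.2 (functionalC S' (prependCoupling b g) i.2.1.1 (pairOfRecord F M k i.1))

/-- The germ index OF AN ADMISSIBLE RUN-B BACKGROUND at a run-A domain: its reading `(ιU, 0)` is a point of every run-B table. [cite: Balaban1987RG1, §1 p.263 (real admissible fields lie in U^c_j)] -/
def germOfAdm (U : AdmBg F M N sp (k + 1)) (X : W1.Dom (F.P k) M) (τ : Bool) : GermIdx F M N k sp :=
  ⟨X, ⟨⟨ofBackgroundC (ιSU N) U.1, U.2 _ _⟩, τ⟩⟩

variable {F M N k sp}

/-- **RESTRICTION FACE: germ-NE5 ⟹ NE5 OF RECORD.** If the configuration transport extends the background transport on readings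
(`Tcfg (ιU,0) = (ι T₀U, 0)`), NE5 over the germ carriers (all table points, both parts) gives node N18's NE5 literal at the admissible reading
(`ReadingData.ne5_ofRecordAdm_iff`) — by evaluation at the index of `U` with the tag `Re`. [cite: Balaban1988RG2Cluster, (2.14) p.15 (the comparison of the two runs' terms)] -/
theorem ne5_readingAdm_of_germ (S : (k : ℕ) → ClusterTower (F.P k) (MatA N) M)
    (gauge : (k : ℕ) → GaugeField (F.P k) 0 (SU N) → GaugeField (F.P k) 0 (SU N) → ℝ) (hg : ∀ k U U', 0 ≤ gauge k U U')
    (T₀ : (k : ℕ) → GaugeField (F.P (k + 1)) 0 (SU N) → GaugeField (F.P k) 0 (SU N))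
    (hT₀ : ∀ (k : ℕ) (U : GaugeField (F.P (k + 1)) 0 (SU N)), (∀ (j : ℕ) (Y : (domSys (F.P (k + 1)) M j).Dom), ofBackgroundC (ιSU N) U ∈ sp (k + 1) j Y) →
      ∀ (j : ℕ) (Y : (domSys (F.P k) M j).Dom), ofBackgroundC (ιSU N) (T₀ k U) ∈ sp k j Y)
    (li : LetterInputs) (γ : ℝ) (Tcfg : CPair (F.P (k + 1)) (MatA N) → CPair (F.P k) (MatA N))
    (hTcfg : ∀ U : AdmBg F M N sp (k + 1), Tcfg (ofBackgroundC (ιSU N) U.1) = ofBackgroundC (ιSU N) (T₀ k U.1))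
    (b : ℝ) (W : Set (ℕ → ℝ)) (κ θ C₅ : ℝ)
    (h : NE5 (C := germCarriers F M N k sp) (EAgerm F M N k sp (S k) Tcfg) (EBgerm F M N k sp (S (k + 1)) b) W κ θ C₅) :
    NE5 (((ReadingData.ofRecordAdm F M N S sp gauge hg T₀ hT₀ li).u3Objects γ).EA k)
      (((ReadingData.ofRecordAdm F M N S sp gauge hg T₀ hT₀ li).u3Objects γ).EB k b) W κ θ C₅ := by
  rw [ReadingData.ne5_ofRecordAdm_iff]
  intro g hg' U X
  have := h g hg' () (germOfAdm F M N k sp U X true)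
  simpa [EAgerm, EBgerm, germOfAdm, germCarriers, hTcfg U] using this

/-- Non-vacuity of the index type: an admissible run-B background gives a germ index at every run-A domain. [cite: Balaban1987RG1, §1 p.263] -/
theorem nonempty_germIdx (U : AdmBg F M N sp (k + 1)) (X : W1.Dom (F.P k) M) : Nonempty (GermIdx F M N k sp) :=
  ⟨germOfAdm F M N k sp U X true⟩

/-! ## The history space and the ℝ-linear total insertion (generic over an index type) -/

namespace GermHist

variable (I : Type)

/-- the history space: bounded complex families over an index type (here: the germ indices). [cite: Balaban1987RG1, (1.18) p.263 (uniformly bounded families of terms)] -/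
abbrev HistSp : Type := lp (fun _ : I => ℂ) ∞

/-- the bounded real tables, as an ℝ-submodule of all real tables (bookkeeping for the ℝ-linear reading). [cite: Balaban1987RG1, (1.18) p.263 (bookkeeping)] -/
def bddTables : Submodule ℝ (I → ℝ) where
  carrier := {s | Memℓp (fun i => ((s i : ℝ) : ℂ)) ∞}
  zero_mem' := by
    change Memℓp (fun i => (((0 : I → ℝ) i : ℝ) : ℂ)) ∞
    simp only [Pi.zero_apply, Complex.ofReal_zero]
    exact memℓp_infty ⟨0, by rintro _ ⟨i, rfl⟩; simp⟩
  add_mem' := by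
    intro s s' hs hs'
    replace hs : Memℓp (fun i => ((s i : ℝ) : ℂ)) ∞ := hs
    replace hs' : Memℓp (fun i => ((s' i : ℝ) : ℂ)) ∞ := hs'
    change Memℓp (fun i => (((s + s') i : ℝ) : ℂ)) ∞
    have : (fun i => (((s + s') i : ℝ) : ℂ)) = (fun i => ((s i : ℝ) : ℂ)) + fun i => ((s' i : ℝ) : ℂ) := by
      funext i; simp
    rw [this]; exact hs.add hs'
  smul_mem' := by
    intro a s hs
    replace hs : Memℓp (fun i => ((s i : ℝ) : ℂ)) ∞ := hs
    change Memℓp (fun i => (((a • s) i : ℝ) : ℂ)) ∞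
    have : (fun i => (((a • s) i : ℝ) : ℂ)) = fun i => (a : ℂ) * ((s i : ℝ) : ℂ) := by
      funext i; simp
    rw [this]; exact hs.const_mul (a : ℂ)

/-- Face. [cite: Balaban1987RG1, (1.18) p.263 (bookkeeping)] -/
theorem mem_bddTables_iff (s : I → ℝ) : s ∈ bddTables I ↔ Memℓp (fun i => ((s i : ℝ) : ℂ)) ∞ := Iff.rfl

/-- A uniformly bounded real table is a bounded table. [cite: Balaban1987RG1, (1.18) p.263 (bookkeeping)] -/
theorem mem_bddTables_of_bound (s : I → ℝ) (B : ℝ) (h : ∀ i, |s i| ≤ B) : s ∈ bddTables I :=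
  memℓp_infty ⟨B, by rintro _ ⟨i, rfl⟩; simpa [Complex.norm_real] using h i⟩

/-- the embedding of bounded real tables into the history space (ℝ-linear; bookkeeping). [cite: Balaban1987RG1, (1.18) p.263 (bookkeeping)] -/
def embBdd : bddTables I →ₗ[ℝ] HistSp I where
  toFun s := ⟨fun i => ((s.1 i : ℝ) : ℂ), s.2⟩
  map_add' s s' := by
    apply lp.ext
    funext i
    simp
  map_smul' a s := by
    apply lp.ext
    funext i
    simp [lp.coeFn_smul]

/-- Face. [cite: Balaban1987RG1, (1.18) p.263 (bookkeeping)] -/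
theorem embBdd_apply (s : bddTables I) (i : I) : (embBdd I s : I → ℂ) i = ((s.1 i : ℝ) : ℂ) := rfl

/-- an ℝ-linear extension of the embedding to ALL real tables (`LinearMap.exists_extend`; never evaluated off the bounded tables in any face —
the schema's insertion laws quantify over all tables, so totality is needed, linearity is what the laws use). [cite: Balaban1987RG1, (1.18) p.263 (bookkeeping)] -/
def embAll : (I → ℝ) →ₗ[ℝ] HistSp I := Classical.choose (LinearMap.exists_extend (embBdd I))

/-- The extension restricts to the embedding. [cite: Balaban1987RG1, (1.18) p.263 (bookkeeping)] -/
theorem embAll_comp : (embAll I).comp (bddTables I).subtype = embBdd I := Classical.choose_spec (LinearMap.exists_extend (embBdd I))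

/-- Face: on a bounded table the reading is the table itself, entrywise. [cite: Balaban1987RG1, (1.18) p.263 (bookkeeping)] -/
theorem embAll_apply_of_mem (s : I → ℝ) (hs : s ∈ bddTables I) (i : I) : (embAll I s : I → ℂ) i = ((s i : ℝ) : ℂ) := by
  have h := congrArg (fun f => f ⟨s, hs⟩) (embAll_comp I)
  simp only [LinearMap.comp_apply, Submodule.subtype_apply] at h
  rw [h]; rfl

/-- The sup norm of the reading of a table bounded by `B ≥ 0` is `≤ B`. [cite: Balaban1987RG1, (1.18) p.263 (bookkeeping)] -/
theorem norm_embAll_le (s : I → ℝ) (B : ℝ) (hB : 0 ≤ B) (h : ∀ i, |s i| ≤ B) : ‖embAll I s‖ ≤ B := by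
  refine lp.norm_le_of_forall_le hB fun i => ?_
  rw [embAll_apply_of_mem I s (mem_bddTables_of_bound I s B h) i, Complex.norm_real, Real.norm_eq_abs]
  exact h i

/-- real scalars act on the history space as the corresponding complex scalars (bookkeeping). [cite: Balaban1987RG1, (1.18) p.263 (bookkeeping)] -/
theorem real_smul_eq_complex_smul (a : ℝ) (x : HistSp I) : a • x = (a : ℂ) • x := by
  apply lp.ext
  funext i
  rw [lp.coeFn_smul, lp.coeFn_smul, Pi.smul_apply, Pi.smul_apply, Complex.real_smul, smul_eq_mul]

end GermHist

/-! ## The history half of a step model OF RECORD over the germ carriers (operator data, output map, base class, margins PARAMETRIC) -/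

section HistModel

variable (F M N k sp)

/-- the history space of record at level `k`: bounded complex families over the germ indices. [cite: Balaban1987RG1, (1.18) p.263] -/
abbrev GHist : Type := GermHist.HistSp (GermIdx F M N k sp)

/-- insertion weight of a germ index at step `n`: scale-`j` entries with `j < n` carry `c·ω^{n−1−j}·rHist n·e^{κ d}`, later scales carry `0`.
[cite: Balaban1988RG2Cluster, (1.24) p.7 (age factor of older terms), (1.26) p.8 (the e^{−κ d_j} decay)] -/
def insWeight (κ c ω : ℝ) (rHist : ℕ → ℝ) (n : ℕ) (i : GermIdx F M N k sp) : ℝ :=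
  if i.1.1 < n then c * ω ^ (n - 1 - i.1.1) * rHist n * Real.exp (κ * (domSys (F.P k) M i.1.1).dj i.1.2) else 0

/-- the weighted table at step `n` (bookkeeping). [cite: Balaban1988RG2Cluster, (1.24) p.7] -/
def weightTable (κ c ω : ℝ) (rHist : ℕ → ℝ) (n : ℕ) (t : GermIdx F M N k sp → ℝ) : GermIdx F M N k sp → ℝ :=
  fun i => insWeight F M N k sp κ c ω rHist n i * t i

/-- Face: additivity in the table. [cite: Balaban1988RG2Cluster, (1.24) p.7 (bookkeeping)] -/
theorem weightTable_add (κ c ω : ℝ) (rHist : ℕ → ℝ) (n : ℕ) (t t' : GermIdx F M N k sp → ℝ) :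
    weightTable F M N k sp κ c ω rHist n (t + t') = weightTable F M N k sp κ c ω rHist n t + weightTable F M N k sp κ c ω rHist n t' := by
  funext i; simp [weightTable, mul_add]

/-- Face: real homogeneity in the table. [cite: Balaban1988RG2Cluster, (1.24) p.7 (bookkeeping)] -/
theorem weightTable_smul (κ c ω : ℝ) (rHist : ℕ → ℝ) (n : ℕ) (a : ℝ) (t : GermIdx F M N k sp → ℝ) :
    weightTable F M N k sp κ c ω rHist n (a • t) = a • weightTable F M N k sp κ c ω rHist n t := by
  funext i; simp [weightTable]; ring

/-- Face: the zero table. [cite: Balaban1988RG2Cluster, (1.24) p.7 (bookkeeping)] -/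
theorem weightTable_zero (κ c ω : ℝ) (rHist : ℕ → ℝ) (n : ℕ) : weightTable F M N k sp κ c ω rHist n 0 = 0 := by
  funext i; simp [weightTable]

/-- Face: the step-`n` weighted table reads only the scales `< n`. [cite: Balaban1988RG2Cluster, (1.33) p.9 (bookkeeping)] -/
theorem weightTable_congr_below (κ c ω : ℝ) (rHist : ℕ → ℝ) (n : ℕ) {t t' : GermIdx F M N k sp → ℝ}
    (h : ∀ i : GermIdx F M N k sp, i.1.1 < n → t i = t' i) :
    weightTable F M N k sp κ c ω rHist n t = weightTable F M N k sp κ c ω rHist n t' := by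
  funext i
  by_cases hi : i.1.1 < n
  · simp [weightTable, h i hi]
  · simp [weightTable, insWeight, hi]

/-- **THE HISTORY INSERTION OF RECORD AT STEP `n`**: the weighted table embedded ℝ-linearly into the history space.
[cite: Balaban1988RG2Cluster, (1.33) p.9 and (1.41) p.11 (the history enters the step-n transformation through all older terms); (1.24) p.7] -/
def insOfRecord (κ c ω : ℝ) (rHist : ℕ → ℝ) (n : ℕ) (t : GermIdx F M N k sp → ℝ) : GHist F M N k sp :=
  GermHist.embAll (GermIdx F M N k sp) (weightTable F M N k sp κ c ω rHist n t)

/-- Face: additivity of the insertion. [cite: Balaban1988RG2Cluster, (1.33) p.9 (bookkeeping)] -/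
theorem insOfRecord_add (κ c ω : ℝ) (rHist : ℕ → ℝ) (n : ℕ) (t t' : GermIdx F M N k sp → ℝ) :
    insOfRecord F M N k sp κ c ω rHist n (t + t') = insOfRecord F M N k sp κ c ω rHist n t + insOfRecord F M N k sp κ c ω rHist n t' := by
  simp [insOfRecord, weightTable_add]

/-- Face: real homogeneity of the insertion. [cite: Balaban1988RG2Cluster, (1.33) p.9 (bookkeeping)] -/
theorem insOfRecord_smul (κ c ω : ℝ) (rHist : ℕ → ℝ) (n : ℕ) (a : ℝ) (t : GermIdx F M N k sp → ℝ) :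
    insOfRecord F M N k sp κ c ω rHist n (a • t) = a • insOfRecord F M N k sp κ c ω rHist n t := by
  simp [insOfRecord, weightTable_smul]

/-- Face: the zero table inserts `0`. [cite: Balaban1988RG2Cluster, (1.33) p.9 (bookkeeping)] -/
theorem insOfRecord_zero (κ c ω : ℝ) (rHist : ℕ → ℝ) (n : ℕ) : insOfRecord F M N k sp κ c ω rHist n 0 = 0 := by
  simp [insOfRecord, weightTable_zero]

/-- Face: subtraction in the table. [cite: Balaban1988RG2Cluster, (1.24) p.7 (bookkeeping)] -/
theorem weightTable_sub (κ c ω : ℝ) (rHist : ℕ → ℝ) (n : ℕ) (t t' : GermIdx F M N k sp → ℝ) :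
    weightTable F M N k sp κ c ω rHist n (t - t') = weightTable F M N k sp κ c ω rHist n t - weightTable F M N k sp κ c ω rHist n t' := by
  funext i; simp [weightTable, mul_sub]

/-- Face: the insertion of a difference of tables. [cite: Balaban1988RG2Cluster, (1.33) p.9 (bookkeeping)] -/
theorem insOfRecord_sub (κ c ω : ℝ) (rHist : ℕ → ℝ) (n : ℕ) (t t' : GermIdx F M N k sp → ℝ) :
    insOfRecord F M N k sp κ c ω rHist n (t - t') = insOfRecord F M N k sp κ c ω rHist n t - insOfRecord F M N k sp κ c ω rHist n t' := by
  simp [insOfRecord, weightTable_sub]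

variable {Op : Type} [NormedAddCommGroup Op] [NormedSpace ℂ Op]

/-- **THE HISTORY HALF OF A STEP MODEL OF RECORD over the germ carriers**: both runs insert their germ tables by `insOfRecord`; the output map,
the operator data, the base class and the margins are PARAMETERS (NODE A ∕ def-B13's objects). [cite: Balaban1988RG2Cluster, (2.13)-(2.14) pp.14-15, (1.33) p.9] -/
def histStepModel (Out : ℕ → Op → GHist F M N k sp → GermIdx F M N k sp → ℂ) (opA opB : (ℕ → ℝ) → Unit → ℕ → Op)
    (Base : ℕ → (ℕ → ℝ) → Unit → Set (Op × GHist F M N k sp)) (rOp rHist : ℕ → ℝ) (hrOp : ∀ n, 0 < rOp n) (hrHist : ∀ n, 0 < rHist n)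
    (κ c ω : ℝ) : StepModel (germCarriers F M N k sp) Op (GHist F M N k sp) where
  Out := Out
  opA := opA
  opB := opB
  insA := fun _ _ n t => insOfRecord F M N k sp κ c ω rHist n t
  insB := fun _ _ n t => insOfRecord F M N k sp κ c ω rHist n t
  Base := Base
  rOp := rOp
  rHist := rHist
  rOp_pos := hrOp
  rHist_pos := hrHist

variable (Out : ℕ → Op → GHist F M N k sp → GermIdx F M N k sp → ℂ) (opA opB : (ℕ → ℝ) → Unit → ℕ → Op)
    (Base : ℕ → (ℕ → ℝ) → Unit → Set (Op × GHist F M N k sp)) (rOp rHist : ℕ → ℝ) (hrOp : ∀ n, 0 < rOp n) (hrHist : ∀ n, 0 < rHist n)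
    (κ c ω : ℝ) (W : Set (ℕ → ℝ))

/-- L09aff BY CONSTRUCTION: the insertion of record is affine (indeed linear) in the table. [cite: Balaban1988RG2Cluster, (1.33) p.9] -/
theorem insAffine_histStepModel : (histStepModel F M N k sp Out opA opB Base rOp rHist hrOp hrHist κ c ω).InsAffine W := by
  intro n g _ U t t'
  change insOfRecord F M N k sp κ c ω rHist n t - insOfRecord F M N k sp κ c ω rHist n t' =
    insOfRecord F M N k sp κ c ω rHist n (t - t') - insOfRecord F M N k sp κ c ω rHist n 0
  rw [insOfRecord_sub, insOfRecord_zero, sub_zero]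

/-- L09blind BY CONSTRUCTION: the step-`n` insertion reads only the scales `< n`. [cite: Balaban1988RG2Cluster, (1.33) p.9 (only g₀,…,g_{n−1} and the terms of order < n enter)] -/
theorem insBlind_histStepModel : (histStepModel F M N k sp Out opA opB Base rOp rHist hrOp hrHist κ c ω).InsBlind W := by
  intro n g _ U t t' h
  change insOfRecord F M N k sp κ c ω rHist n t = insOfRecord F M N k sp κ c ω rHist n t'
  unfold insOfRecord
  rw [weightTable_congr_below F M N k sp κ c ω rHist n (fun i hi => h i hi)]

/-- L09hom BY CONSTRUCTION: real homogeneity of the table-driven part. [cite: Balaban1988RG2Cluster, (1.33) p.9] -/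
theorem insHomog_histStepModel : (histStepModel F M N k sp Out opA opB Base rOp rHist hrOp hrHist κ c ω).InsHomog W := by
  intro n g _ U a t
  change insOfRecord F M N k sp κ c ω rHist n (a • t) - insOfRecord F M N k sp κ c ω rHist n 0 =
    (a : ℂ) • (insOfRecord F M N k sp κ c ω rHist n t - insOfRecord F M N k sp κ c ω rHist n 0)
  rw [insOfRecord_smul, insOfRecord_zero, sub_zero, sub_zero, GermHist.real_smul_eq_complex_smul]

/-- L08 BY CONSTRUCTION with `δ′ = 0`: the two runs insert identically (on germ carriers the run-dependence sits in the TABLES, not in the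
insertion). [cite: Balaban1988RG2Cluster, (2.14) p.15] -/
theorem insertionRate_histStepModel (κ' E₀ θ : ℝ) :
    (histStepModel F M N k sp Out opA opB Base rOp rHist hrOp hrHist κ c ω).InsertionRate W κ' E₀ 0 θ := by
  intro n g _ U t _
  change ‖insOfRecord F M N k sp κ c ω rHist n t - insOfRecord F M N k sp κ c ω rHist n t‖ ≤ 0 * θ ^ n * rHist n
  simp

/-- L09unit BY CONSTRUCTION (a norm identity): a single-scale table of size `E₁e^{−κd}` at scale `j < n` is inserted with norm
`≤ rHist n · c · ω^{n−1−j} · E₁`. [cite: Balaban1988RG2Cluster, (1.24) p.7, (1.26) p.8] -/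
theorem insScaleBound_histStepModel (hc : 0 ≤ c) (hω : 0 ≤ ω) {E₁ : ℝ} (hE₁ : 0 ≤ E₁) :
    (histStepModel F M N k sp Out opA opB Base rOp rHist hrOp hrHist κ c ω).InsScaleBound W κ E₁ c ω := by
  intro n g _ U t j hj hsupp hsize
  change ‖insOfRecord F M N k sp κ c ω rHist n t - insOfRecord F M N k sp κ c ω rHist n 0‖ ≤ rHist n * (c * (ω ^ (n - 1 - j) * E₁))
  rw [insOfRecord_zero, sub_zero]
  have hB : 0 ≤ rHist n * (c * (ω ^ (n - 1 - j) * E₁)) := by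
    have := hrHist n; positivity
  refine GermHist.norm_embAll_le _ _ _ hB fun i => ?_
  by_cases hi : (germCarriers F M N k sp).scale i = j
  · have hsz := hsize i hi
    change i.1.1 = j at hi
    subst hi
    change |t i| ≤ E₁ * Real.exp (-(κ * (domSys (F.P k) M i.1.1).dj i.1.2)) at hsz
    have hwnn : 0 ≤ c * ω ^ (n - 1 - i.1.1) * rHist n * Real.exp (κ * (domSys (F.P k) M i.1.1).dj i.1.2) := by
      have := hrHist n; positivity
    have hw : weightTable F M N k sp κ c ω rHist n t i =
        c * ω ^ (n - 1 - i.1.1) * rHist n * Real.exp (κ * (domSys (F.P k) M i.1.1).dj i.1.2) * t i := by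
      simp [weightTable, insWeight, hj]
    rw [hw, abs_mul, abs_of_nonneg hwnn]
    calc c * ω ^ (n - 1 - i.1.1) * rHist n * Real.exp (κ * (domSys (F.P k) M i.1.1).dj i.1.2) * |t i|
        ≤ c * ω ^ (n - 1 - i.1.1) * rHist n * Real.exp (κ * (domSys (F.P k) M i.1.1).dj i.1.2) *
            (E₁ * Real.exp (-(κ * (domSys (F.P k) M i.1.1).dj i.1.2))) :=
          mul_le_mul_of_nonneg_left hsz hwnn
      _ = rHist n * (c * (ω ^ (n - 1 - i.1.1) * E₁)) := by
          rw [Real.exp_neg]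
          have hpos : Real.exp (κ * (domSys (F.P k) M i.1.1).dj i.1.2) ≠ 0 := (Real.exp_pos _).ne'
          field_simp
  · have h0 := hsupp i hi
    simp [weightTable, h0, hB]

end HistModel

/-! ## L03 ∕ L06's history half: the (1.18) size class on run B's tables gives the decay bound of the germ family -/

section SizeFace

/-- either part of a complex number is bounded by its norm (bookkeeping). [cite: Balaban1987RG1, (1.18) p.263 (bookkeeping)] -/
theorem abs_reIm_le_norm (τ : Bool) (z : ℂ) : |reIm τ z| ≤ ‖z‖ := by
  cases τ
  · exact Complex.abs_im_le_norm z
  · exact Complex.abs_re_le_norm z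

/-- **(1.18) ON RUN B's TABLES ⟹ `DecayBound` OF THE GERM FAMILY**: if, at every history `b∷g`, `g ∈ W`, and every truncation level `K`, run B's terms lie in
W1-13's size class `SizeAdm (sp (k+1)) E₀ κ K`, then both parts of the germ family obey `DecayBound … E₀ κ` on the germ carriers (tree length of the paired
domain = tree length of the run-A domain, `dj_castDom`). [cite: Balaban1987RG1, (1.18) p.263; Balaban1988RG2Cluster, (1.26) p.8] -/
theorem decayBound_EBgerm_of_sizeAdm (S' : ClusterTower (F.P (k + 1)) (MatA N) M) (b : ℝ) (W : Set (ℕ → ℝ)) (E₀ κ : ℝ)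
    (h : ∀ g ∈ W, ∀ K : ℕ, (fun (j : Fin (K + 1)) Y ψ => termC S' j Y (prependCoupling b g) ψ) ∈ SizeAdm (sp (k + 1)) E₀ κ K) :
    DecayBound (C := germCarriers F M N k sp) (EBgerm F M N k sp S' b) W E₀ κ := by
  intro g hg _ i
  obtain ⟨X, ψ, τ⟩ := i
  have hmem := h g hg (pairOfRecord F M k X).1 (Fin.last _) (pairOfRecord F M k X).2 ψ.1 ψ.2
  change |reIm τ (termC S' (pairOfRecord F M k X).1 (pairOfRecord F M k X).2 (prependCoupling b g) ψ.1)| ≤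
    E₀ * Real.exp (-(κ * (domSys (F.P k) M X.1).dj X.2))
  refine (abs_reIm_le_norm τ _).trans ?_
  have hd : (domSys (F.P (k + 1)) M (pairOfRecord F M k X).1).dj (pairOfRecord F M k X).2 = (domSys (F.P k) M X.1).dj X.2 :=
    dj_castDom (domSys_succ F M k X.1).symm X.2
  simpa [hd] using hmem

/-- **(1.18) ON RUN A's TABLES + TABLE TRANSPORT ⟹ `DecayBound` OF RUN A's GERM FUNCTIONAL**: if the configuration transport maps run B's table at
the paired domain into run A's table at the domain (`Tcfg ψ ∈ sp k X.1 X.2` for `ψ ∈ sp (k+1) (πX).1 (πX).2` — the field half of the transport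
clause, a HYPOTHESIS) and run A's terms lie in the size class `SizeAdm (sp k) E₀ κ K` at every `g ∈ W` and `K`, then run A's germ functional obeys
`DecayBound … E₀ κ`. [cite: Balaban1987RG1, (1.18) p.263; Balaban1988RG2Cluster, (1.41) p.11 (the previous-torus terms on the new fields), (1.26) p.8] -/
theorem decayBound_EAgerm_of_sizeAdm (S : ClusterTower (F.P k) (MatA N) M) (Tcfg : CPair (F.P (k + 1)) (MatA N) → CPair (F.P k) (MatA N))
    (hTsp : ∀ (X : W1.Dom (F.P k) M) (ψ : CPair (F.P (k + 1)) (MatA N)),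
      ψ ∈ sp (k + 1) (pairOfRecord F M k X).1 (pairOfRecord F M k X).2 → Tcfg ψ ∈ sp k X.1 X.2)
    (W : Set (ℕ → ℝ)) (E₀ κ : ℝ)
    (h : ∀ g ∈ W, ∀ K : ℕ, (fun (j : Fin (K + 1)) Y ψ => termC S j Y g ψ) ∈ SizeAdm (sp k) E₀ κ K) :
    DecayBound (C := germCarriers F M N k sp) (EAgerm F M N k sp S Tcfg) W E₀ κ := by
  intro g hg _ i
  obtain ⟨X, ψ, τ⟩ := i
  have hmem := h g hg X.1 (Fin.last _) X.2 (Tcfg ψ.1) (hTsp X ψ.1 ψ.2)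
  change |reIm τ (termC S X.1 X.2 g (Tcfg ψ.1))| ≤ E₀ * Real.exp (-(κ * (domSys (F.P k) M X.1).dj X.2))
  exact (abs_reIm_le_norm τ _).trans (by simpa using hmem)

end SizeFace

end W1

end Literature.MathematicalPhysics.QuantumFieldTheory.Balaban1983to89.Node00
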